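import Mathlib.Data.Nat.Factorization.Induction
import Mathlib.Data.PNat.Prime
import Literature.AlgebraicGeometry.Frobenioids.BaseSectionsOfObjects
import Literature.AlgebraicGeometry.Frobenioids.ProfiniteUnitsCocycle
import HarnessLib

/-!
# Frobenioids I, Proposition 5.6 (base-Frobenius pairs of a Frobenius-trivial object are unique up to a unit) — proof

Mochizuki, *The geometry of Frobenioids I*, Kyushu J. Math. **62** (2008), §5, Proposition 5.6,
kurims pp. 105–107 [cite: MochizukiFrdI2008, Prop. 5.6 p.105].  Proof-only companion of
`BaseSectionsOfObjects.lean` (statement `PreFrobenioid.Prop56`, abc-iut-L1-t5), following the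
printed proof (pp. 106–107):

1. `φ'(l) = v_l ∘ φ(l)` for a unit `v_l ∈ O^×(A)` (Def. 1.3 (ii), essential uniqueness of
   Frobenius-type arrows of degree `l` out of `A`);
2. since `φ`, `φ'` are homomorphisms and `C` is Frobenius-normalized and totally epimorphic,
   `v_{l₁}^{l₂-1} = v_{l₂}^{l₁-1}`;
3. by the cocycle lemma on the profinite group `O^×(A)` (`ProfiniteUnitsCocycle`, the pro-`p`
   argument of p. 107) there is `u₀ ∈ O^×(A)` with `u₀^{l-1} = v_l` for all primes `l`; with
   `u := u₀⁻¹`, Frobenius-normalization gives `u ∘ φ(l) ∘ u⁻¹ = φ'(l)` for all primes, hence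
   (prime generation of `ℕ_{≥1}`) for all `n`;
4. for `α ∈ Aut_D(A_D)`, `σ'(α) = v_α ∘ u σ(α) u⁻¹`; functoriality of `F`, `F'` along the
   `P`-arrows `σ(α)`, `σ'(α)` and normalization give `v_α^p = v_α` (`p = 2` suffices), so `v_α = 1`.

**On the hypotheses.** The named statement `Prop56 F B` carries "of model type" as pre-model type
plus `IsOfBiratFrobeniusNormalizedType B` over t3's DATA-ONLY birationalization interface `B`; that
interface cannot transmit the Frobenius-normalization identity in `End_C(A)` which the printed proof
uses (p. 106 "since `C`, being of model type, is also of [birationally] Frobenius-normalized type"),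
so — FINDING D-θ-F1 of the abc-iut cell, accepted by abc-iut-L1-t5 — `Prop56` carries the C-level
hypothesis `IsOfType (IsFrobeniusNormalized F)` (Def. 1.2 (iv)) explicitly, and `prop56_holds`
discharges it as typed.  No new definitions (theorems only).
-/

namespace Literature.AlgebraicGeometry.Frobenioids

open CategoryTheory

universe w v v' u u'

namespace PreFrobenioid

variable {D : Type u} [Category.{v} D] {Φ : Dᵒᵖ ⥤ CommMonCat.{w}}
  {C : Type u'} [Category.{v'} C] (F : C ⥤ ElemFrobenioid Φ)

/-! ### Bookkeeping in `Aut_C(A)` and `End_C(A)` -/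

/-- `(u^n).hom` is the `n`-th power of `u.hom` in `End(A)`. [cite: MochizukiFrdI2008, Prop. 5.6 p.106] -/
theorem Aut.hom_pow {A : C} (u : Aut A) (n : ℕ) : (u ^ n).hom = (End.of u.hom) ^ n := by
  induction n with
  | zero => rfl
  | succ n ih =>
    rw [pow_succ, pow_succ, Aut.Aut_mul_def, Iso.trans_hom, ih, End.mul_def]

/-- Two monoid homomorphisms out of `ℕ_{≥1}` that agree on the primes agree ("`N_{≥1}` is generated
by `Primes`", [FrdI] p. 106). [cite: MochizukiFrdI2008, Prop. 5.6 p.106] -/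
theorem pnat_monoidHom_ext {N : Type*} [Monoid N] {f g : ℕ+ →* N}
    (h : ∀ p : Nat.Primes, f (p : ℕ+) = g (p : ℕ+)) : f = g := by
  have key : ∀ n : ℕ, ∀ m : ℕ+, (m : ℕ) = n → f m = g m := by
    intro n
    induction n using induction_on_primes with
    | zero => intro m hm; exact absurd hm m.ne_zero
    | one =>
      intro m hm
      have h1 : m = 1 := PNat.eq hm
      subst h1
      exact (map_one f).trans (map_one g).symm
    | prime_mul p a hp ih =>
      intro m hm
      have ha : 0 < a := Nat.pos_of_ne_zero fun h0 => m.ne_zero (by rw [hm, h0, mul_zero])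
      let a' : ℕ+ := ⟨a, ha⟩
      have hm' : m = Nat.Primes.toPNat ⟨p, hp⟩ * a' := PNat.eq (by rw [PNat.mul_coe]; exact hm)
      rw [hm', map_mul, map_mul, h, ih a' rfl]
  ext n
  exact key n n rfl

/-- Frobenius-normalization (Def. 1.2 (iv)) in the form used on p. 106: a unit `u ∈ O^×(A)` moves
past a base-identity endomorphism `φ` as `u ∘? …`: `u ≫ φ = φ ≫ u^{deg φ}`.
[cite: MochizukiFrdI2008, Prop. 5.6 p.106] -/
theorem unit_comp_eq_comp_pow {A : C} (hnorm : IsFrobeniusNormalized F A) {φ : A ⟶ A}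
    (hφ : IsBaseIdentity F φ) {u : Aut A} (hu : u ∈ unitsSubgroup F A) :
    u.hom ≫ φ = φ ≫ (u ^ (degFr F φ : ℕ)).hom := by
  rw [Aut.hom_pow]
  exact (hnorm φ hφ (End.of u.hom) hu).symm

/-! ### Step 1: `φ'(n) = φ(n) ≫ v_n` for a unit `v_n` -/

section Restricted

variable {F}
variable {P : Presection C} {Fr : ℕ+ →* End P.ι} {A : C}
  {σ : Aut (baseObj F A) →* Aut A} {φ : ℕ+ →* End A}

/-- The components `φ(n) = F(n)_A` of a restricted pair are base-identity endomorphisms of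
Frobenius type of degree `n`. [cite: MochizukiFrdI2008, Prop. 5.6 p.105] -/
theorem IsRestrictedPair.frobenius (hP : IsBaseFrobeniusPair F P Fr)
    (hr : IsRestrictedPair F P Fr A σ φ) (n : ℕ+) :
    degFr F (End.asHom (φ n)) = n ∧ IsBaseIdentity F (End.asHom (φ n)) ∧
      IsFrobeniusType F (End.asHom (φ n)) := by
  have h1 := hP.isFrobeniusSection.degFr_eq n ⟨A, hr.mem⟩
  have h2 := hP.isFrobeniusSection.isBaseIdentity n ⟨A, hr.mem⟩
  have h3 := hP.isFrobeniusSection.isFrobeniusType n ⟨A, hr.mem⟩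
  rw [← hr.φ_eq n] at h1 h2 h3
  exact ⟨h1, h2, h3⟩

/-- Functoriality of `F` along the `P`-arrows `σ(α)`: `σ(α) ≫ φ(n) = φ(n) ≫ σ(α)`
("it follows from the functoriality of `F`, `F'` that `σ_α · φ_p = φ_p · σ_α`", p. 106).
[cite: MochizukiFrdI2008, Prop. 5.6 p.106] -/
theorem IsRestrictedPair.comm (hr : IsRestrictedPair F P Fr A σ φ) (n : ℕ+)
    (α : Aut (baseObj F A)) :
    (σ α).hom ≫ End.asHom (φ n) = End.asHom (φ n) ≫ (σ α).hom := by
  let A₁ : P.Cat := ⟨A, hr.mem⟩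
  let f : A₁ ⟶ A₁ := ⟨(σ α).hom, hr.σ_mem α⟩
  have hnat := (Fr n).naturality f
  rw [← hr.φ_eq n] at hnat
  exact hnat

end Restricted

/-- **Step 1** (Def. 1.3 (ii)): two base-identity endomorphisms of Frobenius type of the same degree
out of `A` differ by a unit: `φ' = φ ≫ v` with `v ∈ O^×(A)`. [cite: MochizukiFrdI2008, Prop. 5.6 p.106] -/
theorem exists_unit_comp_eq (hF : IsFrobenioid F) {A : C} {φ φ' : A ⟶ A}
    (hφ : IsFrobeniusType F φ) (hφ' : IsFrobeniusType F φ') (hb : IsBaseIdentity F φ)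
    (hb' : IsBaseIdentity F φ') (hdeg : degFr F φ = degFr F φ') :
    ∃ v ∈ unitsSubgroup F A, φ' = φ ≫ v.hom := by
  obtain ⟨β, hβ⟩ := hF.ii_unique φ φ' hφ hφ' hdeg
  refine ⟨β, ⟨?_, isLinear_of_isIso F β.hom⟩, hβ.symm⟩
  have h := congrArg (Base F) hβ
  have hb1 : Base F φ = 𝟙 _ := hb
  have hb2 : Base F φ' = 𝟙 _ := hb'
  rw [base_comp, hb1, hb2, Category.id_comp] at h
  exact h

/-- Units commute in `End(A)` (Remark 1.3.1: `O^×(A)` is commutative).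
[cite: MochizukiFrdI2008, Rem. 1.3.1 p.25] -/
theorem units_hom_comm (hF : IsFrobenioid F) {A : C} {x y : Aut A} (hx : x ∈ unitsSubgroup F A)
    (hy : y ∈ unitsSubgroup F A) : x.hom ≫ y.hom = y.hom ≫ x.hom := by
  have h := unitsSubgroup_comm F hF ⟨x, hx⟩ ⟨y, hy⟩
  have h' := congrArg (fun z : unitsSubgroup F A => (z : Aut A).hom) h
  simp only [Subgroup.coe_mul, Aut.Aut_mul_def, Iso.trans_hom] at h'
  exact h'.symm

/-! ### The theorem -/

/-- **[FrdI] Prop. 5.6, proved under explicit Frobenius-normalization** (see the module docstring and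
FINDING D-θ-F1 for why `IsOfType (IsFrobeniusNormalized F)` is taken as a hypothesis): for a Frobenioid
`C` of Frobenius-normalized and unit-profinite type, two base-Frobenius pairs `(P, F)`, `(P', F')` of
`C` and an object `A` in both `P` and `P'`, the restricted pairs `(σ, φ)`, `(σ', φ')` at `A` are
conjugate, as pairs, by a unit `u ∈ O^×(A)`.  (The hypotheses "isotropic", "pre-model",
"`A` Frobenius-trivial" and the birationalization datum of `Prop56` are not needed.)
[cite: MochizukiFrdI2008, Prop. 5.6 p.105] -/
theorem basePairs_conjugate (hF : IsFrobenioid F) (hnorm : IsOfType (IsFrobeniusNormalized F))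
    (hunit : IsOfUnitProfiniteType F) {P : Presection C} {Fr : ℕ+ →* End P.ι}
    {P' : Presection C} {Fr' : ℕ+ →* End P'.ι} (hP : IsBaseFrobeniusPair F P Fr)
    (hP' : IsBaseFrobeniusPair F P' Fr') {A : C} {σ σ' : Aut (baseObj F A) →* Aut A}
    {φ φ' : ℕ+ →* End A} (hr : IsRestrictedPair F P Fr A σ φ)
    (hr' : IsRestrictedPair F P' Fr' A σ' φ') :
    ∃ u ∈ unitsSubgroup F A, PairConjugate F u σ σ' φ φ' := by
  classical
  have hepi : ∀ {X Y : C} (f : X ⟶ Y), Epi f := fun f => hF.isPreFrobenioid.isTotallyEpimorphic.epi f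
  -- Step 1: the units `v n` with `φ' n = φ n ≫ v n`
  have hv : ∀ n : ℕ+, ∃ v ∈ unitsSubgroup F A, End.asHom (φ' n) = End.asHom (φ n) ≫ v.hom :=
    fun n => exists_unit_comp_eq F hF (hr.frobenius hP n).2.2 (hr'.frobenius hP' n).2.2
      (hr.frobenius hP n).2.1 (hr'.frobenius hP' n).2.1
      ((hr.frobenius hP n).1.trans (hr'.frobenius hP' n).1.symm)
  choose v hvmem hv using hv
  -- Frobenius-normalization: `w ≫ φ n = φ n ≫ w^n` for units `w`
  have hnφ : ∀ (n : ℕ+) {w : Aut A}, w ∈ unitsSubgroup F A →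
      w.hom ≫ End.asHom (φ n) = End.asHom (φ n) ≫ (w ^ ((n : ℕ+) : ℕ)).hom := by
    intro n w hw
    have := unit_comp_eq_comp_pow F (hnorm A) (hr.frobenius hP n).2.1 hw
    rwa [(hr.frobenius hP n).1] at this
  -- `φ`, `φ'` take commuting values
  have hcomm : ∀ (ψ : ℕ+ →* End A) (m n : ℕ+),
      End.asHom (ψ m) ≫ End.asHom (ψ n) = End.asHom (ψ n) ≫ End.asHom (ψ m) := by
    intro ψ m n
    have h1 : End.asHom (ψ (n * m)) = End.asHom (ψ m) ≫ End.asHom (ψ n) := by rw [map_mul]; rfl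
    have h2 : End.asHom (ψ (m * n)) = End.asHom (ψ n) ≫ End.asHom (ψ m) := by rw [map_mul]; rfl
    rw [← h1, ← h2, mul_comm]
  -- Step 2: the cocycle `v l₁ ^ (l₂ - 1) = v l₂ ^ (l₁ - 1)` in the commutative group `O^×(A)`
  letI : CommGroup (unitsSubgroup F A) := unitsCommGroup F hF A
  let vv : Nat.Primes → unitsSubgroup F A := fun l => ⟨v l, hvmem l⟩
  have hcocycle : ∀ l₁ l₂ : Nat.Primes,
      vv l₁ ^ ((l₂ : ℕ) - 1) = vv l₂ ^ ((l₁ : ℕ) - 1) := by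
    intro l₁ l₂
    -- `φ' l₁ ≫ φ' l₂ = φ' l₂ ≫ φ' l₁`, expanded
    have key : (v l₁ ^ ((l₂ : ℕ+) : ℕ)).hom ≫ (v l₂).hom =
        (v l₂ ^ ((l₁ : ℕ+) : ℕ)).hom ≫ (v l₁).hom := by
      have e := hcomm φ' l₁ l₂
      rw [hv l₁, hv l₂, Category.assoc, Category.assoc, reassoc_of% (hnφ l₂ (hvmem l₁)),
        reassoc_of% (hnφ l₁ (hvmem l₂)), reassoc_of% (hcomm φ l₂ l₁)] at e
      exact (cancel_epi _).mp ((cancel_epi _).mp e)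
    -- as an identity in `Aut A`: `v l₂ * v l₁ ^ l₂ = v l₁ * v l₂ ^ l₁`
    have key' : v l₂ * v l₁ ^ ((l₂ : ℕ+) : ℕ) = v l₁ * v l₂ ^ ((l₁ : ℕ+) : ℕ) := by
      ext
      rw [Aut.Aut_mul_def, Aut.Aut_mul_def, Iso.trans_hom, Iso.trans_hom]
      exact key
    -- in the subgroup
    have key'' : vv l₂ * vv l₁ ^ ((l₂ : ℕ+) : ℕ) = vv l₁ * vv l₂ ^ ((l₁ : ℕ+) : ℕ) :=
      Subtype.ext key'
    have h₁ : ((l₂ : ℕ+) : ℕ) = ((l₂ : ℕ) - 1) + 1 := (Nat.sub_add_cancel l₂.2.one_lt.le).symm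
    have h₂ : ((l₁ : ℕ+) : ℕ) = ((l₁ : ℕ) - 1) + 1 := (Nat.sub_add_cancel l₁.2.one_lt.le).symm
    rw [h₁, h₂, pow_succ, pow_succ] at key''
    -- cancel `vv l₁ * vv l₂`
    have : vv l₁ * vv l₂ * vv l₁ ^ ((l₂ : ℕ) - 1) = vv l₁ * vv l₂ * vv l₂ ^ ((l₁ : ℕ) - 1) := by
      calc vv l₁ * vv l₂ * vv l₁ ^ ((l₂ : ℕ) - 1)
          = vv l₂ * (vv l₁ ^ ((l₂ : ℕ) - 1) * vv l₁) := by
            rw [mul_comm (vv l₁) (vv l₂), mul_assoc, mul_comm (vv l₁)]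
        _ = vv l₁ * (vv l₂ ^ ((l₁ : ℕ) - 1) * vv l₂) := key''
        _ = vv l₁ * vv l₂ * vv l₂ ^ ((l₁ : ℕ) - 1) := by rw [mul_assoc, mul_comm (vv l₂ ^ _)]
    exact mul_left_cancel this
  -- Step 3: the profinite topology of `O^×(A)` and the cocycle lemma; `u := u₀⁻¹`
  obtain ⟨t, ht⟩ := hunit A
  letI : TopologicalSpace (unitsSubgroup F A) := t
  obtain ⟨u₀, hu₀⟩ := IsTfgProfinite.exists_pow_pred_eq ht vv hcocycle
  set uA : Aut A := ((u₀⁻¹ : unitsSubgroup F A) : Aut A) with huA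
  have huAmem : uA ∈ unitsSubgroup F A := (u₀⁻¹).2
  have huAinv : uA.inv = (u₀ : Aut A).hom := by
    rw [huA, Subgroup.coe_inv, Aut.Aut_inv_def, Iso.symm_inv]
  have huAhom : uA.hom = (u₀ : Aut A).inv := by
    rw [huA, Subgroup.coe_inv, Aut.Aut_inv_def, Iso.symm_hom]
  -- conjugation of `φ` at primes …
  have hprime : ∀ l : Nat.Primes,
      End.asHom (φ' l) = uA.inv ≫ End.asHom (φ l) ≫ uA.hom := by
    intro l
    have hU : ((vv l : unitsSubgroup F A) : Aut A) = (u₀ : Aut A) ^ ((l : ℕ) - 1) := by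
      rw [← hu₀ l, Subgroup.coe_pow]
    have hl1 : ((l : ℕ+) : ℕ) = ((l : ℕ) - 1) + 1 := (Nat.sub_add_cancel l.2.one_lt.le).symm
    have e1 : v (l : ℕ+) = (u₀ : Aut A)⁻¹ * (u₀ : Aut A) ^ ((l : ℕ+) : ℕ) := by
      rw [hl1, pow_succ', inv_mul_cancel_left, ← hU]
    have hvl : (v l).hom = ((u₀ : Aut A) ^ ((l : ℕ+) : ℕ)).hom ≫ (u₀ : Aut A).inv := by
      have e2 := congrArg Iso.hom e1
      rw [Aut.Aut_mul_def, Iso.trans_hom, Aut.Aut_inv_def, Iso.symm_hom] at e2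
      exact e2
    rw [hv l, hvl, huAinv, huAhom, ← Category.assoc (u₀ : Aut A).hom, hnφ l u₀.2, Category.assoc]
  -- … hence for all `n`
  let c : End A →* End A :=
    { toFun := fun x => End.of (uA.inv ≫ End.asHom x ≫ uA.hom)
      map_one' := by simp [End.one_def]
      map_mul' := fun x y => by simp [End.mul_def] }
  have hall : ∀ n : ℕ+, End.asHom (φ' n) = uA.inv ≫ End.asHom (φ n) ≫ uA.hom := by
    have heq : φ' = c.comp φ := pnat_monoidHom_ext fun p => hprime p
    intro n
    exact congrArg (fun ψ : ℕ+ →* End A => End.asHom (ψ n)) heq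
  refine ⟨uA, huAmem, fun α => ?_, fun n => hall n⟩
  -- Step 4: the section part `σ' α = uA.symm ≪≫ σ α ≪≫ uA`
  set τ : Aut A := uA.symm ≪≫ σ α ≪≫ uA with hτ
  set vα : Aut A := τ.symm ≪≫ σ' α with hvαdef
  have hσ' : σ' α = τ ≪≫ vα := by rw [hvαdef, Iso.self_symm_id_assoc]
  have hbu : Base F uA.hom = 𝟙 _ := huAmem.1
  have hbui : Base F uA.inv = 𝟙 _ := by
    have := ((unitsSubgroup F A).inv_mem huAmem).1
    rwa [Aut.Aut_inv_def] at this
  have hbσ : Base F (σ α).inv = α.inv := congrArg Iso.inv (hr.base_σ α)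
  have hbσ' : Base F (σ' α).hom = α.hom := congrArg Iso.hom (hr'.base_σ α)
  have hvα : vα ∈ unitsSubgroup F A := by
    refine ⟨?_, isLinear_of_isIso F _⟩
    show Base F (τ.inv ≫ (σ' α).hom) = 𝟙 _
    rw [hτ]
    simp only [Iso.trans_inv, Iso.symm_inv, base_comp, hbu, hbui, hbσ, hbσ', Category.assoc,
      Category.id_comp, Category.comp_id, Iso.inv_hom_id]
  -- functoriality of `F'` along `σ' α` at `p = 2`, rewritten with `φ' 2 = uA⁻¹ φ 2 uA`
  have e := hr'.comm 2 α
  have hs' : (σ' α).hom = uA.inv ≫ (σ α).hom ≫ uA.hom ≫ vα.hom := by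
    rw [hσ', Iso.trans_hom, hτ, Iso.trans_hom, Iso.trans_hom, Iso.symm_hom, Category.assoc,
      Category.assoc]
  rw [hs', hall 2] at e
  simp only [Category.assoc] at e
  have hcw : uA.hom ≫ vα.hom = vα.hom ≫ uA.hom := units_hom_comm F hF huAmem hvα
  rw [reassoc_of% hcw, hcw, Iso.hom_inv_id_assoc, Iso.hom_inv_id_assoc,
    reassoc_of% (hnφ 2 hvα), reassoc_of% (hr.comm 2 α)] at e
  -- e : uA.inv ≫ φ 2 ≫ σα ≫ (vα^2).hom ≫ uA.hom = uA.inv ≫ φ 2 ≫ σα ≫ vα.hom ≫ uA.hom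
  have e3 : (vα ^ ((2 : ℕ+) : ℕ)).hom = vα.hom :=
    (cancel_mono uA.hom).mp ((cancel_epi (σ α).hom).mp
      ((cancel_epi (End.asHom (φ 2))).mp ((cancel_epi uA.inv).mp e)))
  have hsq : vα ^ ((2 : ℕ+) : ℕ) = vα := Iso.ext e3
  have hv1 : vα = 1 := by
    have : vα * vα = vα * 1 := by rw [mul_one, ← pow_two]; exact hsq
    exact mul_left_cancel this
  rw [hσ', hv1]
  exact Iso.trans_refl _

variable (B : (PreFrobenioidData.ofFunctor Φ F).BiratData) in
/-- **[FrdI] Proposition 5.6 — discharged as typed** (`Prop56 F B`, abc-iut-L1-t5, re-typed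
20:31Z with the explicit antecedent `IsOfType (IsFrobeniusNormalized F)` after FINDING D-θ-F1):
immediate from `basePairs_conjugate`; the antecedents "pre-model", "birationally
Frobenius-normalized w.r.t. `B`", "isotropic" and "`A` Frobenius-trivial" are not used.
[cite: MochizukiFrdI2008, Prop. 5.6 p.105] -/
theorem prop56_holds : Prop56 F B := by
  intro hF _ _ hnorm _ hunit P Fr P' Fr' hP hP' A _ σ σ' φ φ' hr hr'
  exact basePairs_conjugate F hF hnorm hunit hP hP' hr hr'

/-! ### From the printed hypothesis "of model type" -/

/-- **Def. 4.5 (i), bracket p. 86 / Prop. 4.4 (ii)**: a birationally Frobenius-normalized `C` is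
Frobenius-normalized, provided the birationalization datum `B` IS the birationalization to the
extent recorded by Prop. 4.4 (i), (ii) (`B.Prop44i`: `C → C^birat` lies over `D` and preserves
Frobenius degrees; `B.Prop44ii`: it is faithful and carries `O^▷(A)` into `O^×(A^birat)`).  The
identity `α^d ∘ φ = φ ∘ α` is pulled back from `End(A^birat)` along the faithful functor.
[cite: MochizukiFrdI2008, Def. 4.5 (i) p.86] -/
theorem isFrobeniusNormalized_of_birat (B : (PreFrobenioidData.ofFunctor Φ F).BiratData)
    (h44i : PreFrobenioidData.Prop44i B) (h44ii : PreFrobenioidData.Prop44ii B)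
    (hB : PreFrobenioidData.IsOfBiratFrobeniusNormalizedType B) :
    IsOfType (IsFrobeniusNormalized F) := by
  intro A φ hφ α hα
  haveI : B.toBirat.Faithful := h44ii.2.1
  -- the image of `φ` is base-identity, of the same degree; the image of `α` lies in `O^▷(A^birat)`
  have hψ : B.ops.IsBaseIdentity (B.toBirat.map φ) := by
    have hnat := B.overBase.hom.naturality φ
    have hφ' : (PreFrobenioidData.ofFunctor Φ F).base.map φ = 𝟙 _ := hφ
    rw [hφ', Category.comp_id] at hnat
    -- hnat : (toBirat ⋙ ops.base).map φ ≫ η_A = η_A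
    have := congrArg (· ≫ B.overBase.inv.app A) hnat
    simp only [Category.assoc, Iso.hom_inv_id_app, Category.comp_id] at this
    exact this
  have hdeg : B.ops.degFr (B.toBirat.map φ) = degFr F φ := h44i.2 φ
  obtain ⟨-, hβb, hβl⟩ := h44ii.2.2 A α hα
  have key := hB.obj A (B.toBirat.map φ) hψ (B.toBirat.map α) ⟨hβb, hβl⟩
  rw [hdeg] at key
  -- pull back along the faithful functor
  have key' : B.toBirat.map (End.of (α ^ (degFr F φ : ℕ) * End.of φ)) =
      B.toBirat.map (End.of (End.of φ * α)) := by
    have h1 := (B.toBirat.mapEnd A).map_mul (α ^ (degFr F φ : ℕ)) (End.of φ)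
    have h2 := (B.toBirat.mapEnd A).map_mul (End.of φ) α
    have h3 := (B.toBirat.mapEnd A).map_pow α (degFr F φ : ℕ)
    simp only [Functor.mapEnd_apply] at h1 h2 h3
    rw [h1, h2, h3]
    exact key
  exact B.toBirat.map_injective key'

variable (B : (PreFrobenioidData.ofFunctor Φ F).BiratData) in
/-- **Prop. 5.6 with the printed hypothesis list** ("`C` of model and unit-profinite type"), for a
birationalization datum `B` satisfying Prop. 4.4 (i), (ii): the explicit Frobenius-normalization
antecedent of `Prop56` is then automatic (`isFrobeniusNormalized_of_birat`).
[cite: MochizukiFrdI2008, Prop. 5.6 p.105] -/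
theorem prop56_of_prop44 (h44i : PreFrobenioidData.Prop44i B) (h44ii : PreFrobenioidData.Prop44ii B) :
    IsFrobenioid F → IsOfPreModelType F → PreFrobenioidData.IsOfBiratFrobeniusNormalizedType B →
      IsOfIsotropicType F → IsOfUnitProfiniteType F →
      ∀ (P : Presection C) (Fr : ℕ+ →* End P.ι) (P' : Presection C) (Fr' : ℕ+ →* End P'.ι),
        IsBaseFrobeniusPair F P Fr → IsBaseFrobeniusPair F P' Fr' →
        ∀ (A : C), IsFrobeniusTrivial F A →
          ∀ (σ σ' : Aut (baseObj F A) →* Aut A) (φ φ' : ℕ+ →* End A),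
            IsRestrictedPair F P Fr A σ φ → IsRestrictedPair F P' Fr' A σ' φ' →
              ∃ u ∈ unitsSubgroup F A, PairConjugate F u σ σ' φ φ' := by
  intro hF _ hB _ hunit P Fr P' Fr' hP hP' A _ σ σ' φ φ' hr hr'
  exact basePairs_conjugate F hF (isFrobeniusNormalized_of_birat F B h44i h44ii hB) hunit hP hP'
    hr hr'

end PreFrobenioid

end Literature.AlgebraicGeometry.Frobenioids
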